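import Literature.NumberTheory.EllipticCurves.TateModule
import Literature.NumberTheory.EllipticCurves.IsogenyGroundFieldExtension
import Summits.BirchSwinnertonDyer.BirchSwinnertonDyer.Theorems.PrintCf2SplitBadTwoCMEigenDecomposition
import Summits.BirchSwinnertonDyer.BirchSwinnertonDyer.Theorems.PrintCf2SplitBadTwoCMEndomorphismSqrtMinusSeven
import HarnessLib

/-!
# Crux `PrintCf2.SplitBadTwoRankOneOfFacts` (item stmt-BirchSwinnertonDyer-20368), road α over the CM field:
# THE CM-PRIME DECOMPOSITION `E_L[2^∞] = E[𝔭^∞] ⊕ E[𝔭̄^∞]` AS `Γ_L`-MODULES over every number field `L ∋ √−7`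

Cell `bsd-print-cf2`, width seat `bsd-line-cf2-p1-w2` g7; `--supports stmt-BirchSwinnertonDyer-20368` (helper). HONEST FRAMING:
nothing here closes a crux or a stub; BSD is not proved by any of this; no summit statement is proved by this seat.

WHAT IT IS FOR. Road α of crux 20368 (GL₁ Iwasawa theory over the CM field `K₀ = ℚ(√−7)`, `2 = 𝔭𝔭̄` split; -w3 g2/g3
`Lines/rubin_value_two*.lean`, `Theorems/PrintCf2SplitBadTwoHalvesOverCMField.lean`) needs its algebraic research statement H₂
(rank-one `𝔭`-adic descent) typed on the `𝔭`-PRIMARY summand `E[𝔭^∞] ⊂ E[2^∞]` — on the full module the reversed Selmer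
conditions are torsion on one CM summand only (`K0ROAD-TURNKEY-w3g2.md` §2; planner RULING (y)(4) «make W[𝔭₀^∞] ⊂ W[2^∞]
available as a Γ_{K₀}-submodule for H₂»). This file supplies that object, definition-free, for every member of the class with
`j = −3375` (CM by the MAXIMAL order; the `j = 16581375` members, CM by `ℤ[√−7]` of conductor `2`, are `2`-isogenous over `ℚ` to
`j = −3375` members and have NO integral CM splitting at `2` — there the two CM lines meet in the rational `2`-torsion point):

* `exists_cmEndo_baseChange` — `π = [(1+√−7)/2]` on `E_L = (W.baseChange L)` for `L/ℚ` algebraic (transport of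
  `exists_cmEndo_of_j_eq_neg3375` along `E(ℚ̄) ≃ E_L(L̄)`, the tree's `geomPointsExtend` / `isAlgebraicOn_congr_of_algEquiv`);
* `exists_cmPrimaryDecomposition_two` — **for `W/ℚ` elliptic with `j = −3375` and a number field `L ∋ θ`, `θ² = −7`: an
  `L`-rational `π ∈ End_L(E_L)` (`π² = π − 2`, `#ker π = #ker π̄ = 2`, `π(σP) = σ(πP)`), the root `r ∈ 2ℤ₂` of `X² − X + 2`, and
  subgroups `C₁ = E[𝔭^∞]` (`π` acts as `r`), `C₂ = E[𝔭̄^∞]` (`π` acts as `1 − r`) of `E_L[2^∞] = (W.baseChange L).geomPrimaryTorsion 2`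
  with `C₁ ⊓ C₂ = ⊥`, `C₁ ⊔ C₂ = ⊤`, `C₁ ≠ ⊥ ≠ C₂`, BOTH STABLE under `Γ_L`** (membership spelled in the integer-approximation
  currency of `stub_ordinaryFiltrationAtTwo`: `∀ k N, 2^k x = 0 → N ≡ r (2^k) → π x = N x`).
Assembly: the eigen-decomposition algebra `CMPrimes.exists_eigenDecomposition` (companion file …CMEigenDecomposition) for the
restriction of `π` to `E_L[2^∞]`, the `Γ_L`-equivariance `CMPrimes.cmEndo_mem_endRing_of_sq_eq_neg_seven` (companion file
…CMEndomorphismSqrtMinusSeven), non-triviality from `E[𝔭] = ker π ⊆ C₁`, `E[𝔭̄] = ker π̄ ⊆ C₂` (`2P = π̄πP`).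
NOT here (next files): the identification of `C₁`/`C₂` with Greenberg's local line at a place `v ∣ 2` (p640618
`EisensteinTwo.stub_ordinaryFiltrationAtTwo`), the corank-one structure `Cᵢ ≅ ℚ₂/ℤ₂`, and the complex-conjugation swap.

References: K. Rubin, LNM 1716 §2 (`E[𝔞]`, `E[𝔭^∞]` for CM curves), Prop. 5.4; J. Coates, *Infinite descent on elliptic curves
with complex multiplication* (1983) §2; [SilvermanATAEC1994] II §1 Prop. 1.1, II §2 Thm. 2.2(b), App. A §3; [SilvermanAEC2009]
III.§4, III.§7.
-/

noncomputable section

open scoped Classical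

set_option linter.dupNamespace false
set_option autoImplicit false

namespace Summit.BirchSwinnertonDyer.BirchSwinnertonDyer.Theorems.PrintCf2.CMPrimes

section Curve

open WeierstrassCurve Literature.NumberTheory.EllipticCurves Field

/-- **Base change of `π`.** For `W/ℚ` with `j = −3375` and an algebraic extension `L/ℚ` (e.g. a number field), the base change
`W_L` carries `π_L ∈ End_{L̄}(E_L)` with `π_L² = π_L − 2`, `#ker π_L = 2 = #ker(1 − π_L)`: transport of `exists_cmEndo_of_j_eq_neg3375`
along `E(ℚ̄) ≃ E_L(L̄)` (the tree's `geomPointsExtend`, `isAlgebraicOn_congr_of_algEquiv`; Silverman, *AEC*, III.§4: an isogeny is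
a morphism over the algebraic closure). [cite: SilvermanAEC2009, III.§4 (Definition, p. 66) with I.§3 Ex. 1.12(c)] -/
theorem exists_cmEndo_baseChange (W : WeierstrassCurve ℚ) [W.IsElliptic] (hj : W.j = -3375)
    (L : Type) [Field L] [Algebra ℚ L] [Algebra.IsAlgebraic ℚ L] :
    ∃ π : AddMonoid.End (W.baseChange L).geomPoints, π ∈ (W.baseChange L).geomEndRing ∧ π * π = π - 2 ∧
      Nat.card (π : (W.baseChange L).geomPoints →+ (W.baseChange L).geomPoints).ker = 2 ∧
      Nat.card ((1 - π : AddMonoid.End (W.baseChange L).geomPoints) :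
        (W.baseChange L).geomPoints →+ (W.baseChange L).geomPoints).ker = 2 := by
  obtain ⟨π₀, hπ₀, hrel₀, hker₀, hker₀'⟩ := exists_cmEndo_of_j_eq_neg3375 W hj
  -- `π₀ ≠ 0` (else `2 = 0` in the characteristic-zero ring `End_{ℚ̄}(E)`), hence algebraic
  have hπ₀0 : π₀ ≠ 0 := by
    intro h0
    haveI := charZero_geomEndRing W
    have h2 : ((⟨π₀, hπ₀⟩ : W.geomEndRing) : W.geomEndRing) * ⟨π₀, hπ₀⟩ = ⟨π₀, hπ₀⟩ - 2 :=
      Subtype.ext (by push_cast; exact hrel₀)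
    have : (⟨π₀, hπ₀⟩ : W.geomEndRing) = 0 := Subtype.ext h0
    rw [this, mul_zero, zero_sub, eq_comm, neg_eq_zero] at h2
    exact two_ne_zero h2
  have halg₀ : IsAlgebraicOn W W π₀ := ((mem_geomEndRing_iff_holds W π₀).mp hπ₀).resolve_left hπ₀0
  set ι := Literature.NumberTheory.GaloisRepresentations.absClosureEquiv ℚ L with hι
  set β := W.geomPointsExtend L ι with hβ
  set π : AddMonoid.End (W.baseChange L).geomPoints :=
    (β.toAddMonoidHom.comp (π₀ : W.geomPoints →+ W.geomPoints)).comp β.symm.toAddMonoidHom with hπ_def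
  have hπapp : ∀ Q, π Q = β (π₀ (β.symm Q)) := fun Q ↦ rfl
  have halg : IsAlgebraicOn (W.baseChange L) (W.baseChange L) π :=
    isAlgebraicOn_congr_of_algEquiv ι β (fun _ ↦ rfl) β (fun _ ↦ rfl) halg₀
  refine ⟨π, Subring.subset_closure halg, ?_, ?_, ?_⟩
  · -- `π² = π − 2`
    ext Q
    have e : (π - 2 : AddMonoid.End (W.baseChange L).geomPoints) Q = π Q - 2 • Q := by
      change (π : _ →+ _) Q - ((2 : AddMonoid.End (W.baseChange L).geomPoints) : _ →+ _) Q = _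
      simp
    refine Eq.trans ?_ e.symm
    change π (π Q) = _
    rw [hπapp, hπapp, β.symm_apply_apply, cmEndo_apply_apply W hrel₀, map_sub, map_nsmul, β.apply_symm_apply]
  · rw [← hker₀]
    refine Nat.card_congr (Equiv.subtypeEquiv β.symm.toEquiv fun Q ↦ ?_)
    change π Q = 0 ↔ π₀ (β.symm Q) = 0
    rw [hπapp, β.map_eq_zero_iff]
  · rw [← hker₀']
    refine Nat.card_congr (Equiv.subtypeEquiv β.symm.toEquiv fun Q ↦ ?_)
    change (1 - π : AddMonoid.End (W.baseChange L).geomPoints) Q = 0 ↔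
      (1 - π₀ : AddMonoid.End W.geomPoints) (β.symm Q) = 0
    have e1 : (1 - π : AddMonoid.End (W.baseChange L).geomPoints) Q = Q - π Q := by
      change ((1 : AddMonoid.End (W.baseChange L).geomPoints) : _ →+ _) Q - (π : _ →+ _) Q = _
      simp
    have e2 : (1 - π₀ : AddMonoid.End W.geomPoints) (β.symm Q) = β.symm Q - π₀ (β.symm Q) := by
      change ((1 : AddMonoid.End W.geomPoints) : _ →+ _) (β.symm Q) - (π₀ : _ →+ _) (β.symm Q) = _
      simp
    rw [e1, e2, hπapp, ← β.map_eq_zero_iff, map_sub, β.apply_symm_apply]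

/-- **THE CM-PRIME DECOMPOSITION AT `2` OVER A FIELD CONTAINING `√−7`** (the `Γ_L`-module `E[𝔭^∞]` that the road-α research
statement H₂ is typed on).  Let `W/ℚ` be elliptic with `j(W) = −3375` (CM by `𝓞 = ℤ[(1+√−7)/2]`, e.g. every `49a1^{(d)}`), `L` a number
field with `θ ∈ L`, `θ² = −7` (e.g. `K₀ = ℚ(√−7)`, where `2 = 𝔭𝔭̄` SPLITS).  Then on `E_L` there are: the `L`-RATIONAL endomorphism
`π = [(1+√−7)/2]` (`π² = π − 2`, `#ker π = #ker π̄ = 2`, `π(σP) = σ(πP)` for all `σ ∈ Γ_L`), the `2`-adic root `r` of `X² − X + 2`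
with `‖r‖ < 1` (so `r ↔ 𝔭 = (π)`, `1 − r ↔ 𝔭̄`), and two `Γ_L`-STABLE subgroups `C₁ = E[𝔭^∞]` (where `π` acts as `r`), `C₂ = E[𝔭̄^∞]`
(where `π` acts as `r̄ = 1 − r`) of `E_L[2^∞]` with `C₁ ⊓ C₂ = 0`, `C₁ + C₂ = E[2^∞]`, both non-zero (`E[𝔭] ⊆ C₁`, `E[𝔭̄] ⊆ C₂`).
Road α′ of crux 20368 (GL₁ over `K₀`): the `𝔭`-primary Selmer/Ш objects live on `C₁`; Rubin 1991 §11, Coates 1983 (infinite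
descent: `Sel_{𝔭^∞}` vs `Gal(M_∞/K(E[𝔭^∞]))`). Nothing here is specific to the crux's reduction type at `2`.
[cite: SilvermanATAEC1994, II §1 Prop. 1.1, II §2 Thm. 2.2(b), App. A §3 (row D = -7)] -/
theorem exists_cmPrimaryDecomposition_two (W : WeierstrassCurve ℚ) [W.IsElliptic] (hj : W.j = -3375)
    (L : Type) [Field L] [NumberField L] {θ : L} (hθ : θ ^ 2 = -7) :
    ∃ (π : AddMonoid.End (W.baseChange L).geomPoints) (r : ℤ_[2])
      (C₁ C₂ : AddSubgroup ((W.baseChange L).geomPrimaryTorsion 2)),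
      π ∈ (W.baseChange L).endRing ∧ π * π = π - 2 ∧
      Nat.card (π : (W.baseChange L).geomPoints →+ (W.baseChange L).geomPoints).ker = 2 ∧
      Nat.card ((1 - π : AddMonoid.End (W.baseChange L).geomPoints) :
        (W.baseChange L).geomPoints →+ (W.baseChange L).geomPoints).ker = 2 ∧
      (∀ (σ : absoluteGaloisGroup L) (P : (W.baseChange L).geomPoints), π (σ • P) = σ • π P) ∧
      r * r = r - 2 ∧ ‖r‖ < 1 ∧
      (∀ x, x ∈ C₁ ↔ ∀ (k : ℕ) (N : ℤ), 2 ^ k • x = 0 →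
        ((N : ℤ_[2]) - r) ∈ (Ideal.span {(2 : ℤ_[2]) ^ k} : Ideal ℤ_[2]) →
          π (x : (W.baseChange L).geomPoints) = N • (x : (W.baseChange L).geomPoints)) ∧
      (∀ x, x ∈ C₂ ↔ ∀ (k : ℕ) (N : ℤ), 2 ^ k • x = 0 →
        ((N : ℤ_[2]) - (1 - r)) ∈ (Ideal.span {(2 : ℤ_[2]) ^ k} : Ideal ℤ_[2]) →
          π (x : (W.baseChange L).geomPoints) = N • (x : (W.baseChange L).geomPoints)) ∧
      C₁ ⊓ C₂ = ⊥ ∧ C₁ ⊔ C₂ = ⊤ ∧ C₁ ≠ ⊥ ∧ C₂ ≠ ⊥ ∧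
      (∀ σ : absoluteGaloisGroup L, (∀ x ∈ C₁, σ • x ∈ C₁) ∧ (∀ x ∈ C₂, σ • x ∈ C₂)) := by
  haveI : Fact (Nat.Prime 2) := ⟨Nat.prime_two⟩
  obtain ⟨π, hπ, hrel, hker, hker'⟩ := exists_cmEndo_baseChange W hj L
  have hjV : (W.baseChange L).j = -3375 := by simp only [baseChange, map_j, hj]; norm_num
  obtain ⟨hπend, hequiv⟩ := cmEndo_mem_endRing_of_sq_eq_neg_seven (W.baseChange L) hjV hθ hπ hrel
  obtain ⟨r, hr, hrlt, hsum, hprod, hunit⟩ := exists_padicInt_two_root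
  -- the restriction of `π` to `M = E_L[2^∞]`
  set M := ↥((W.baseChange L).geomPrimaryTorsion 2) with hM_def
  have hmem : ∀ x : M, π (x : (W.baseChange L).geomPoints) ∈ (W.baseChange L).geomPrimaryTorsion 2 := fun x ↦ by
    obtain ⟨k, hk⟩ := (AddCommGroup.mem_primaryComponent).mp x.2
    exact (AddCommGroup.mem_primaryComponent).mpr ⟨k, by rw [← map_nsmul, hk, map_zero]⟩
  let πM : M →+ M :=
    { toFun := fun x ↦ ⟨π (x : (W.baseChange L).geomPoints), hmem x⟩
      map_zero' := Subtype.ext (by simp)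
      map_add' := fun x y ↦ Subtype.ext (by
        change π ((x : (W.baseChange L).geomPoints) + y) = π x + π y
        rw [map_add]) }
  have hπM : ∀ x : M, ((πM x : M) : (W.baseChange L).geomPoints) = π (x : (W.baseChange L).geomPoints) := fun _ ↦ rfl
  have hMp : ∀ x : M, ∃ k : ℕ, 2 ^ k • x = 0 := fun x ↦ by
    obtain ⟨k, hk⟩ := (AddCommGroup.mem_primaryComponent).mp x.2
    exact ⟨k, Subtype.ext (by rw [AddSubmonoidClass.coe_nsmul, ZeroMemClass.coe_zero]; exact hk)⟩
  have hπMrel : ∀ x : M, πM (πM x) = (1 : ℤ) • πM x - (2 : ℤ) • x := fun x ↦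
    Subtype.ext (by
      rw [AddSubgroupClass.coe_sub, AddSubgroupClass.coe_zsmul, AddSubgroupClass.coe_zsmul, hπM, hπM, one_zsmul,
        cmEndo_apply_apply (W.baseChange L) hrel]
      norm_cast)
  have hsum' : r + (1 - r) = ((1 : ℤ) : ℤ_[2]) := by push_cast; ring
  have hprod' : r * (1 - r) = ((2 : ℤ) : ℤ_[2]) := by exact_mod_cast hprod
  obtain ⟨C₁, C₂, hC₁, hC₂, hinf, hsup, hstab, -⟩ :=
    exists_eigenDecomposition (p := 2) hMp πM hπMrel hsum' hprod' hunit
  -- translate the membership conditions from `πM` (on `M`) to `π` (on `E_L(L̄)`)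
  have htr : ∀ (ρ : ℤ_[2]) (x : M),
      (∀ (k : ℕ) (N : ℤ), 2 ^ k • x = 0 →
        ((N : ℤ_[2]) - ρ) ∈ (Ideal.span {(2 : ℤ_[2]) ^ k} : Ideal ℤ_[2]) → πM x = N • x) ↔
      (∀ (k : ℕ) (N : ℤ), 2 ^ k • x = 0 →
        ((N : ℤ_[2]) - ρ) ∈ (Ideal.span {(2 : ℤ_[2]) ^ k} : Ideal ℤ_[2]) →
          π (x : (W.baseChange L).geomPoints) = N • (x : (W.baseChange L).geomPoints)) := fun ρ x ↦ by
    refine forall_congr' fun k ↦ forall_congr' fun N ↦ forall_congr' fun _ ↦ forall_congr' fun _ ↦ ?_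
    rw [Subtype.ext_iff, hπM, AddSubgroupClass.coe_zsmul]
  refine ⟨π, r, C₁, C₂, hπend, hrel, hker, hker', hequiv, hr, hrlt,
    fun x ↦ (hC₁ x).trans (htr r x), fun x ↦ (hC₂ x).trans (htr (1 - r) x), hinf, hsup, ?_, ?_, ?_⟩
  · -- `C₁ ≠ ⊥`: a non-zero point of `ker π = E[𝔭]` lies in `C₁`
    obtain ⟨P, hP, hP0⟩ : ∃ P : (W.baseChange L).geomPoints, π P = 0 ∧ P ≠ 0 := by
      by_contra hno
      push Not at hno
      have : (π : (W.baseChange L).geomPoints →+ (W.baseChange L).geomPoints).ker = ⊥ := by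
        rw [eq_bot_iff]; intro P hPk; exact (AddSubgroup.mem_bot).mpr (hno P hPk)
      rw [this, AddSubgroup.card_bot] at hker
      exact absurd hker (by norm_num)
    have h2P : 2 • P = 0 := by
      have h := cmEndo_apply_apply (W.baseChange L) hrel P
      rw [hP, map_zero, zero_sub, eq_comm, neg_eq_zero] at h
      exact h
    have hPM : P ∈ (W.baseChange L).geomPrimaryTorsion 2 := (AddCommGroup.mem_primaryComponent).mpr ⟨1, by rw [pow_one, h2P]⟩
    intro hbot
    have hx : (⟨P, hPM⟩ : M) ∈ C₁ := by
      rw [hC₁]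
      refine eigen_of_level πM r (k := 1) (N₁ := 0)
        (Subtype.ext (by rw [AddSubmonoidClass.coe_nsmul, ZeroMemClass.coe_zero, pow_one]; exact h2P)) ?_ (Subtype.ext ?_)
      · rw [Int.cast_zero, zero_sub, Ideal.neg_mem_iff, Ideal.mem_span_singleton, pow_one]
        exact (PadicInt.norm_lt_one_iff_dvd r).mp hrlt
      · rw [hπM, zero_zsmul]; exact hP
    rw [hbot, AddSubgroup.mem_bot] at hx
    exact hP0 (congrArg Subtype.val hx)
  · -- `C₂ ≠ ⊥`: a non-zero point of `ker (1 − π) = E[𝔭̄]` lies in `C₂`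
    obtain ⟨P, hP, hP0⟩ : ∃ P : (W.baseChange L).geomPoints, π P = P ∧ P ≠ 0 := by
      by_contra hno
      push Not at hno
      have : ((1 - π : AddMonoid.End (W.baseChange L).geomPoints) : (W.baseChange L).geomPoints →+ (W.baseChange L).geomPoints).ker = ⊥ := by
        rw [eq_bot_iff]; intro P hPk
        have e1 : (1 - π : AddMonoid.End (W.baseChange L).geomPoints) P = P - π P := by
          change ((1 : AddMonoid.End (W.baseChange L).geomPoints) : _ →+ _) P - (π : _ →+ _) P = _
          simp
        have hPk' : P - π P = 0 := by rw [← e1]; exact hPk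
        exact (AddSubgroup.mem_bot).mpr (hno P (sub_eq_zero.mp hPk').symm)
      rw [this, AddSubgroup.card_bot] at hker'
      exact absurd hker' (by norm_num)
    have h2P : 2 • P = 0 := by
      have h := cmEndo_apply_apply (W.baseChange L) hrel P
      rw [hP, hP, eq_comm, sub_eq_self] at h
      exact h
    have hPM : P ∈ (W.baseChange L).geomPrimaryTorsion 2 := (AddCommGroup.mem_primaryComponent).mpr ⟨1, by rw [pow_one, h2P]⟩
    intro hbot
    have hx : (⟨P, hPM⟩ : M) ∈ C₂ := by
      rw [hC₂]
      refine eigen_of_level πM (1 - r) (k := 1) (N₁ := 1)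
        (Subtype.ext (by rw [AddSubmonoidClass.coe_nsmul, ZeroMemClass.coe_zero, pow_one]; exact h2P)) ?_ (Subtype.ext ?_)
      · rw [Int.cast_one, sub_sub_cancel, Ideal.mem_span_singleton, pow_one]
        exact (PadicInt.norm_lt_one_iff_dvd r).mp hrlt
      · rw [hπM, one_zsmul]; exact hP
    rw [hbot, AddSubgroup.mem_bot] at hx
    exact hP0 (congrArg Subtype.val hx)
  · -- `Γ_L`-stability: every `σ` commutes with `π`
    intro σ
    exact hstab (DistribMulAction.toAddMonoidEnd (absoluteGaloisGroup L) M σ) fun x ↦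
      Subtype.ext (by
        change σ • π (x : (W.baseChange L).geomPoints) = π (σ • (x : (W.baseChange L).geomPoints))
        rw [hequiv])

end Curve

end Summit.BirchSwinnertonDyer.BirchSwinnertonDyer.Theorems.PrintCf2.CMPrimes

end
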